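import Summits.Ventures.YMGap.FlowData.RectTubeMassGapPrimePos
import Summits.Ventures.YMGap.FlowData.RectTubeKernelNearIdentity
import HarnessLib

/-!
# Venture YMGap, track Y3 FLOW-DATA — the `e = 0` gap `m′` of a finite `SU(2)` tube DIVERGES at strong coupling:
# `m′(β) ≥ −ln(e^{β(#P+N)} − 1) − ln(20/3)` once `e^{β(#P+N)} − 1 ≤ ¼`, hence `m′(β) → +∞` as `β → 0⁺` (theorems only)

HONEST FRAMING: venture file of the cell `pub-ymgap` (QuantumFields programme), track Y3; companion THEOREMS for
`FlowData/RectTubeVacuumProjection.lean` (`su2RectMassGapPrime` = the FLOW-TABLE's `m′`, FLOW-PLAN O5).  FINITE rectangular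
torus only: the bound degrades with the volume (`#P + N` = spatial plaquettes + spatial links of ONE time slice) and says
nothing about `L → ∞`, the continuum, or a mass gap in the thermodynamic sense; it is the elementary statement that at
`β = 0` the transfer operator is the rank-one projection onto the constants, plus first-order perturbation theory with
explicit constants.  No number of the FLOW-TABLE, no row.

THE ARGUMENT.  `‖Tψ − ⟪1,ψ⟫1‖ ≤ η‖ψ‖` with `η := e^{|J| n (#P+N)} − 1` and the first-order perturbation lemma
`norm_apply_le_of_near_rankOne` (`‖Tψ‖ ≤ 5η‖ψ‖` on `φ₀^⊥` once `η ≤ ¼`) are in `RectTubeKernelNearIdentity`; with Jentzsch's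
vacuum package (`RectTubeMassGapPrime.exists_rectVacuum_gap`) this bounds the excited norm `‖T ∘ (P_0 − P_Ω)‖ ≤ 5η`, and
`m′ = ln ‖T‖ − ln ‖T ∘ (P_0 − P_Ω)‖ ≥ ln(3/4) − ln(5η)` (`0 < ‖T ∘ (P_0 − P_Ω)‖` from `RectTubeMassGapPrimePos`).

* `rectTubeExcitedNorm_le_of_orth_bound` — `‖T ∘ (P_0 − P_Ω)‖ ≤ θ` as soon as `‖Tw‖ ≤ θ‖w‖` on `φ₀^⊥`;
* `rectTubeExcitedNorm_le_of_small` — `‖T ∘ (P_0 − P_Ω)‖ ≤ 5(e^{|J| n (#P+N)} − 1)` once the bracket is `≤ ¼`;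
* **`su2RectMassGapPrime_ge_of_small`** — `−log(e^{β(#P+N)} − 1) − log(20/3) ≤ su2RectMassGapPrime β Ls` (`β > 0`,
  `e^{β(#P+N)} − 1 ≤ ¼`, an axis `μ`);
* **`su2RectMassGapPrime_ge_log`** — explicit rate `log β⁻¹ − log(#P+N) − log(25/3) ≤ su2RectMassGapPrime β Ls` once
  `e^{β(#P+N)} ≤ 5/4`;
* **`tendsto_su2RectMassGapPrime_atTop`** — `su2RectMassGapPrime β Ls → +∞` as `β → 0⁺`.

References: M. Reed, B. Simon IV (1978) §XIII.12 [cite: ReedSimonIV1978, §XIII.12]; T. Kato, *Perturbation Theory for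
Linear Operators* (1966), Ch. II §1 [folklore]; I. Montvay, G. Münster (1994) §3.2.6 [cite: MontvayMunster1994, §3.2.6].
-/

noncomputable section

open scoped BigOperators ENNReal InnerProductSpace
open MeasureTheory Filter Function Topology
open Literature.MathematicalPhysics.QuantumFieldTheory Literature.Analysis.OperatorTheory
open Literature.MathematicalPhysics.QuantumLattice (RectTorusSite fundamentalRep continuous_fundamentalRep
  fundamentalRep_mem_unitaryGroup)
open Summit.Ventures.LatticeQCDFlow.Exactness Summit.Ventures.LatticeQCDFlow.Scoring
open Literature.Barriers.QuantumFields

namespace Summit.Ventures.YMGap.FlowData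

/-! ### The excited norm under an orthogonal-complement bound -/

section Gap

variable {G : Type*} [Group G] [TopologicalSpace G] [IsTopologicalGroup G] [CompactSpace G]
  [MeasurableSpace G] [BorelSpace G] [SecondCountableTopology G] {n : ℕ} (ρ : G →* Matrix (Fin n) (Fin n) ℂ)
  (J : ℝ) {k : ℕ} {Ls : Fin k → ℕ} [∀ i, NeZero (Ls i)]

omit [SecondCountableTopology G] in
/-- **`‖T ∘ (P_0 − P_Ω)‖ ≤ θ` as soon as `‖T w‖ ≤ θ‖w‖` on `φ₀^⊥`** (`P_Ω = ⟪φ₀,·⟫φ₀`, `P_0 φ₀ = φ₀`, `‖φ₀‖ = 1`, central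
involution `z`): `P_0ψ − ⟪φ₀,ψ⟫φ₀ = P_0(ψ − ⟪φ₀,ψ⟫φ₀)` is orthogonal to `φ₀` and no longer than `ψ`. [cite: ReedSimonIV1978, §XIII.12] -/
theorem rectTubeExcitedNorm_le_of_orth_bound {z : G} (hzz : z * z = 1) {φ₀ : Lp ℝ 2 (rectSliceMeasure G Ls)}
    (h1 : ‖φ₀‖ = 1) (hP0 : rectTubeFluxProjection z Ls 0 φ₀ = φ₀)
    (hvac : ∀ ψ, rectTubeVacuumProjection ρ J Ls ψ = (@inner ℝ _ _ φ₀ ψ) • φ₀) {θ : ℝ} (hθ0 : 0 ≤ θ)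
    (hgap : ∀ w : Lp ℝ 2 (rectSliceMeasure G Ls), @inner ℝ _ _ φ₀ w = 0 →
      ‖rectTubeTransferOperator ρ J Ls w‖ ≤ θ * ‖w‖) :
    rectTubeExcitedNorm ρ z J Ls ≤ θ := by
  unfold rectTubeExcitedNorm excitedSectorNorm
  refine ContinuousLinearMap.opNorm_le_bound _ hθ0 fun ψ => ?_
  rw [ContinuousLinearMap.comp_apply]
  simp only [FunLike.coe_sub, Pi.sub_apply]
  rw [show fluxProjection (rectFluxTwistOp Ls z) 0 = rectTubeFluxProjection z Ls 0 from rfl,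
    show vacuumProjection (rectTubeTransferOperator ρ J Ls) = rectTubeVacuumProjection ρ J Ls from rfl, hvac ψ]
  have hsa := isSelfAdjoint_rectTubeFluxProjection (Ls := Ls) z hzz 0
  have hinnerP : @inner ℝ _ _ φ₀ (rectTubeFluxProjection z Ls 0 ψ) = @inner ℝ _ _ φ₀ ψ := by
    have h := (ContinuousLinearMap.isSelfAdjoint_iff_isSymmetric.1 hsa) φ₀ ψ
    rw [ContinuousLinearMap.coe_coe, hP0] at h
    exact h.symm
  have hw0 : @inner ℝ _ _ φ₀ (rectTubeFluxProjection z Ls 0 ψ - (@inner ℝ _ _ φ₀ ψ) • φ₀) = 0 := by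
    rw [inner_sub_right, hinnerP, real_inner_smul_right, real_inner_self_eq_norm_sq, h1, one_pow, mul_one, sub_self]
  have hfactor : rectTubeFluxProjection z Ls 0 ψ - (@inner ℝ _ _ φ₀ ψ) • φ₀ =
      rectTubeFluxProjection z Ls 0 (ψ - (@inner ℝ _ _ φ₀ ψ) • φ₀) := by
    rw [map_sub, map_smul, hP0]
  have hnorm : ‖rectTubeFluxProjection z Ls 0 ψ - (@inner ℝ _ _ φ₀ ψ) • φ₀‖ ≤ ‖ψ‖ := by
    rw [hfactor]
    calc ‖rectTubeFluxProjection z Ls 0 (ψ - (@inner ℝ _ _ φ₀ ψ) • φ₀)‖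
        ≤ ‖rectTubeFluxProjection z Ls 0‖ * ‖ψ - (@inner ℝ _ _ φ₀ ψ) • φ₀‖ := ContinuousLinearMap.le_opNorm _ _
      _ ≤ 1 * ‖ψ‖ := mul_le_mul (norm_fluxProjection_le_one (fun s => norm_rectFluxTwistOp_le_one (Ls := Ls) z s) 0)
          (inner_sub_inner_smul_eq_zero_and_norm_le h1 ψ).2 (norm_nonneg _) zero_le_one
      _ = ‖ψ‖ := one_mul _
  calc ‖rectTubeTransferOperator ρ J Ls (rectTubeFluxProjection z Ls 0 ψ - (@inner ℝ _ _ φ₀ ψ) • φ₀)‖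
      ≤ θ * ‖rectTubeFluxProjection z Ls 0 ψ - (@inner ℝ _ _ φ₀ ψ) • φ₀‖ := hgap _ hw0
    _ ≤ θ * ‖ψ‖ := mul_le_mul_of_nonneg_left hnorm hθ0

/-- **`‖T ∘ (P_0 − P_Ω)‖ ≤ 5 (e^{|J| n (#P+N)} − 1)`** once `e^{|J| n (#P+N)} − 1 ≤ ¼` (continuous unitary `ρ`, central
involution `z`): Jentzsch's vacuum package and the first-order perturbation lemma with `e = 1`. [folklore] -/
theorem rectTubeExcitedNorm_le_of_small (hρ : Continuous ρ) (hρu : ∀ g, ρ g ∈ Matrix.unitaryGroup (Fin n) ℂ) {z : G}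
    (hz : z ∈ Subgroup.center G) (hzz : z * z = 1)
    (hη : Real.exp (|J| * n * (Fintype.card (RectTorusSite Ls) * Fintype.card {p : Fin k × Fin k // p.1 < p.2} +
        Fintype.card (RectTorusSite Ls × Fin k))) - 1 ≤ 1 / 4) :
    rectTubeExcitedNorm ρ z J Ls ≤
      5 * (Real.exp (|J| * n * (Fintype.card (RectTorusSite Ls) * Fintype.card {p : Fin k × Fin k // p.1 < p.2} +
        Fintype.card (RectTorusSite Ls × Fin k))) - 1) := by
  set η : ℝ := Real.exp (|J| * n * (Fintype.card (RectTorusSite Ls) * Fintype.card {p : Fin k × Fin k // p.1 < p.2} +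
        Fintype.card (RectTorusSite Ls × Fin k))) - 1 with hηdef
  have hη0 : 0 ≤ η := by
    rw [hηdef, sub_nonneg]
    exact Real.one_le_exp (by positivity)
  obtain ⟨φ₀, h1, -, heig, -, hP0, hvac, -⟩ := exists_rectVacuum_gap ρ J (Ls := Ls) hρ hρu hz
  have hone : ‖Lp.const 2 (rectSliceMeasure G Ls) (1 : ℝ)‖ = 1 := by
    rw [Lp.norm_const' (μ := rectSliceMeasure G Ls) (p := 2) (c := (1 : ℝ)) two_ne_zero ENNReal.ofNat_ne_top, norm_one,
      probReal_univ, Real.one_rpow, mul_one]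
  refine rectTubeExcitedNorm_le_of_orth_bound ρ J hzz h1 hP0 hvac (by positivity) fun w hw => ?_
  exact norm_apply_le_of_near_rankOne (rectTubeTransferOperator ρ J Ls) hone h1 heig hη0 hη
    (norm_rectTubeTransferOperator_sub_rankOne_le ρ J hρ hρu) hw

end Gap


/-! ### `SU(2)`: the explicit lower bound and the divergence of `m′` at strong coupling -/

section SU2

variable {k : ℕ}

/-- **`m′(β) ≥ −log(e^{β(#P+N)} − 1) − log(20/3)`** on every rectangular `SU(2)` tube, for every `β > 0` with
`e^{β(#P+N)} − 1 ≤ ¼` (`#P = #sites·k(k−1)/2`, `N = #sites·k`; an axis `μ` is needed for `0 < ‖T ∘ (P_0 − P_Ω)‖`).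
Finite volume; the constant degrades with the volume. [folklore] -/
theorem su2RectMassGapPrime_ge_of_small {β : ℝ} (hβ : 0 < β) (Ls : Fin k → ℕ) [∀ i, NeZero (Ls i)] (μ : Fin k)
    (hη : Real.exp (β * (Fintype.card (RectTorusSite Ls) * Fintype.card {p : Fin k × Fin k // p.1 < p.2} +
        Fintype.card (RectTorusSite Ls × Fin k))) - 1 ≤ 1 / 4) :
    -Real.log (Real.exp (β * (Fintype.card (RectTorusSite Ls) * Fintype.card {p : Fin k × Fin k // p.1 < p.2} +
        Fintype.card (RectTorusSite Ls × Fin k))) - 1) - Real.log (20 / 3) ≤ su2RectMassGapPrime β Ls := by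
  haveI : SecondCountableTopology (Matrix.specialUnitaryGroup (Fin 2) ℂ) := secondCountableTopology_su2
  set S : ℝ := (Fintype.card (RectTorusSite Ls) : ℝ) * (Fintype.card {p : Fin k × Fin k // p.1 < p.2} : ℝ) +
        (Fintype.card (RectTorusSite Ls × Fin k) : ℝ) with hS
  set η : ℝ := Real.exp (β * S) - 1 with hηdef
  have hJ : |β / 2| * ((2 : ℕ) : ℝ) * S = β * S := by
    rw [abs_of_pos (half_pos hβ)]; push_cast; ring
  have hS0 : 0 ≤ S := by rw [hS]; positivity
  have hηpos : 0 < η := by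
    rw [hηdef, sub_pos]
    exact Real.one_lt_exp_iff.2 (mul_pos_iff.2 (Or.inl ⟨hβ, lt_of_le_of_ne hS0 fun h => by
      -- `S = 0` is impossible: there is at least the site-line along `μ`
      have hN : 0 < (Fintype.card (RectTorusSite Ls × Fin k) : ℝ) := by
        have : 0 < Fintype.card (RectTorusSite Ls × Fin k) := Fintype.card_pos_iff.2 ⟨(0, μ)⟩
        exact_mod_cast this
      rw [hS] at h
      have : (0 : ℝ) ≤ (Fintype.card (RectTorusSite Ls) : ℝ) * (Fintype.card {p : Fin k × Fin k // p.1 < p.2} : ℝ) := by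
        positivity
      linarith⟩))
  have hE := rectTubeExcitedNorm_le_of_small (fundamentalRep (Fin 2)) (β / 2) (Ls := Ls) (continuous_fundamentalRep (Fin 2))
    fundamentalRep_mem_unitaryGroup su2MinusOne_mem_center su2MinusOne_mul_self (by rw [hJ]; exact hη)
  rw [hJ] at hE
  have hT := two_sub_exp_le_norm_rectTubeTransferOperator (fundamentalRep (Fin 2)) (β / 2) (Ls := Ls)
    (continuous_fundamentalRep (Fin 2)) fundamentalRep_mem_unitaryGroup
  rw [hJ] at hT
  have hEpos : 0 < su2RectExcitedNorm β Ls := su2_rectExcitedNorm_pos hβ Ls μ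
  rw [su2RectMassGapPrime_eq]
  unfold su2RectExcitedNorm at hEpos ⊢
  have h34 : (3 : ℝ) / 4 ≤ ‖rectTubeTransferOperator (fundamentalRep (Fin 2)) (β / 2) Ls‖ := by
    rw [hηdef] at hη; linarith
  have hlogT : Real.log (3 / 4) ≤ Real.log ‖rectTubeTransferOperator (fundamentalRep (Fin 2)) (β / 2) Ls‖ :=
    Real.log_le_log (by norm_num) h34
  have hlogE : Real.log (rectTubeExcitedNorm (fundamentalRep (Fin 2)) su2MinusOne (β / 2) Ls) ≤ Real.log (5 * η) :=
    Real.log_le_log hEpos hE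
  have hsplit : Real.log (5 * η) = Real.log 5 + Real.log η := Real.log_mul (by norm_num) hηpos.ne'
  have hconst : -Real.log (20 / 3) = Real.log (3 / 4) - Real.log 5 := by
    rw [show (20 : ℝ) / 3 = 5 / (3 / 4) by norm_num, Real.log_div (by norm_num) (by norm_num)]; ring
  rw [hsplit] at hlogE
  linarith

/-- **Explicit rate: `m′(β) ≥ log β⁻¹ − log(#P+N) − log(25/3)`** on every rectangular `SU(2)` tube, for every `β > 0`
with `e^{β(#P+N)} ≤ 5/4` (then `e^{β(#P+N)} − 1 ≤ (5/4)β(#P+N) ≤ ¼`).  Finite volume only. [folklore] -/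
theorem su2RectMassGapPrime_ge_log {β : ℝ} (hβ : 0 < β) (Ls : Fin k → ℕ) [∀ i, NeZero (Ls i)] (μ : Fin k)
    (h54 : Real.exp (β * (Fintype.card (RectTorusSite Ls) * Fintype.card {p : Fin k × Fin k // p.1 < p.2} +
        Fintype.card (RectTorusSite Ls × Fin k))) ≤ 5 / 4) :
    -Real.log β - Real.log ((Fintype.card (RectTorusSite Ls) : ℝ) * Fintype.card {p : Fin k × Fin k // p.1 < p.2} +
        Fintype.card (RectTorusSite Ls × Fin k)) - Real.log (25 / 3) ≤ su2RectMassGapPrime β Ls := by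
  set S : ℝ := (Fintype.card (RectTorusSite Ls) : ℝ) * (Fintype.card {p : Fin k × Fin k // p.1 < p.2} : ℝ) +
        (Fintype.card (RectTorusSite Ls × Fin k) : ℝ) with hS
  have hSpos : 0 < S := by
    have hN : 0 < (Fintype.card (RectTorusSite Ls × Fin k) : ℝ) := by
      have : 0 < Fintype.card (RectTorusSite Ls × Fin k) := Fintype.card_pos_iff.2 ⟨(0, μ)⟩
      exact_mod_cast this
    have : (0 : ℝ) ≤ (Fintype.card (RectTorusSite Ls) : ℝ) * (Fintype.card {p : Fin k × Fin k // p.1 < p.2} : ℝ) := by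
      positivity
    rw [hS]; linarith
  have hx0 : 0 ≤ β * S := (mul_pos hβ hSpos).le
  have hη : Real.exp (β * S) - 1 ≤ 5 / 4 * (β * S) := exp_sub_one_le_mul_of_exp_le hx0 h54
  have hηpos : 0 < Real.exp (β * S) - 1 := sub_pos.2 (Real.one_lt_exp_iff.2 (mul_pos hβ hSpos))
  have hη4 : Real.exp (β * S) - 1 ≤ 1 / 4 := by linarith
  have h1 := su2RectMassGapPrime_ge_of_small hβ Ls μ hη4
  have h2 : Real.log (Real.exp (β * S) - 1) ≤ Real.log (5 / 4 * (β * S)) := Real.log_le_log hηpos hη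
  rw [Real.log_mul (by norm_num) (mul_pos hβ hSpos).ne', Real.log_mul hβ.ne' hSpos.ne'] at h2
  have h3 : Real.log (25 / 3) = Real.log (5 / 4) + Real.log (20 / 3) := by
    rw [← Real.log_mul (by norm_num) (by norm_num)]; norm_num
  rw [h3]
  linarith

/-- **The finite-volume `e = 0` gap diverges at strong coupling: `su2RectMassGapPrime β Ls → +∞` as `β → 0⁺`**
(every rectangular `SU(2)` tube with an axis `μ`).  Finite volume only. [folklore] -/
theorem tendsto_su2RectMassGapPrime_atTop (Ls : Fin k → ℕ) [∀ i, NeZero (Ls i)] (μ : Fin k) :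
    Tendsto (fun β => su2RectMassGapPrime β Ls) (𝓝[>] 0) atTop := by
  set S : ℝ := (Fintype.card (RectTorusSite Ls) : ℝ) * (Fintype.card {p : Fin k × Fin k // p.1 < p.2} : ℝ) +
        (Fintype.card (RectTorusSite Ls × Fin k) : ℝ) with hS
  -- `η(β) = e^{βS} − 1 → 0⁺`, so `−log η(β) → +∞`
  have hη : Tendsto (fun β : ℝ => Real.exp (β * S) - 1) (𝓝[>] 0) (𝓝[>] 0) := by
    have hS0 : 0 ≤ S := by rw [hS]; positivity
    have hSpos : 0 < S := by
      have hN : 0 < (Fintype.card (RectTorusSite Ls × Fin k) : ℝ) := by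
        have : 0 < Fintype.card (RectTorusSite Ls × Fin k) := Fintype.card_pos_iff.2 ⟨(0, μ)⟩
        exact_mod_cast this
      have : (0 : ℝ) ≤ (Fintype.card (RectTorusSite Ls) : ℝ) * (Fintype.card {p : Fin k × Fin k // p.1 < p.2} : ℝ) := by
        positivity
      rw [hS]; linarith
    have h1 : Tendsto (fun β : ℝ => Real.exp (β * S) - 1) (𝓝 0) (𝓝 0) := by
      have : Continuous fun β : ℝ => Real.exp (β * S) - 1 := by continuity
      have h := this.tendsto 0
      rwa [zero_mul, Real.exp_zero, sub_self] at h
    refine tendsto_nhdsWithin_iff.2 ⟨h1.mono_left nhdsWithin_le_nhds, ?_⟩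
    filter_upwards [self_mem_nhdsWithin] with β (hβ : 0 < β)
    exact sub_pos.2 (Real.one_lt_exp_iff.2 (mul_pos hβ hSpos))
  have hlog : Tendsto (fun β : ℝ => -Real.log (Real.exp (β * S) - 1) - Real.log (20 / 3)) (𝓝[>] 0) atTop := by
    have h1 : Tendsto (fun β : ℝ => -Real.log (Real.exp (β * S) - 1)) (𝓝[>] 0) atTop := by
      have h2 := Real.tendsto_log_nhdsGT_zero.comp hη
      exact tendsto_neg_atBot_atTop.comp h2
    exact tendsto_atTop_add_const_right _ _ h1
  -- eventually `η(β) ≤ ¼`, and then the explicit bound applies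
  have hev : ∀ᶠ β in 𝓝[>] (0 : ℝ), Real.exp (β * S) - 1 ≤ 1 / 4 := by
    have h := (tendsto_nhdsWithin_iff.1 hη).1
    exact (h.eventually (eventually_le_nhds (show (0 : ℝ) < 1 / 4 by norm_num)))
  refine tendsto_atTop_mono' _ ?_ hlog
  filter_upwards [hev, self_mem_nhdsWithin] with β hβη (hβ : 0 < β)
  exact su2RectMassGapPrime_ge_of_small hβ Ls μ hβη

end SU2

end Summit.Ventures.YMGap.FlowData
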